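import Summits.QuantumFields.YangMills.Theorems.ForcedResponseSkewnessRunningCouplingCeilingLogCeilingOfFemto
import Summits.QuantumFields.YangMills.Theorems.ForcedResponseSkewnessRunningCouplingCeilingOfKernelBounds
import HarnessLib

/-!
# Route `ForcedResponseSkewness`, crux `RunningCouplingCeiling` (stmt-QuantumFields-24275): the crux BY NAME from two
# FEMTO statements — the femto boundary law and a femto log two-point law along the pinned unit

Helper file (`--supports stmt-QuantumFields-24275`) of the width prover `ym-line-frs-p3` (g5); Sig-level compositions of
`…RunningCouplingCeilingLogCeilingOfFemto.lean`:

* `scaleFreeLocalPinnedSigR_of_fblPinned` — the registered `stub_scaleFreeLocal : ScaleFreeLocalPinnedSigR` of line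
  «pointwise-log-ceiling-r» is DISCHARGED by the femto boundary law along the pinned unit — VERBATIM the body of
  `ResponseLocalisation.Birth.FBLPinnedSigR`, i.e. the lead's `stub_fblPinned` of line «femto-collar» on the deciding crux 24869
  (written out here; the two cruxes SHARE that stub);
* `logCeilingSigR_of_femto` — `ScaleFreeLocalPinnedSigR →` (FBL, pinned) `→` (femto log two-point law, pinned; INLINE
  hypothesis) `→ LogCeilingSigR` (the registered `stub_logCeiling`);
* `runningCouplingCeiling_of_femto` — `RunningCouplingCeiling` BY NAME from the two femto statements
  (via `runningCouplingCeiling_of_localKernelBounds`, p594732): the line closes modulo `stub_fblPinned` (shared) and ONE femto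
  asymptotic-freedom statement.

No summit is proved by any of this: the line is a CONDITIONAL rung line (leaf R2a `BalabanLadder.NT`, residual
`FloorWithScalingLimits` 24873); `stub_logCeiling` is only REDUCED to a femto statement; the Yang–Mills mass gap is NOT proved.
-/

set_option autoImplicit false

noncomputable section

namespace Summit.QuantumFields.YangMills.Cruxes.RunningCouplingCeiling.Pointwise

open scoped SchwartzMap
open MeasureTheory Filter Topology
open Literature.MathematicalPhysics.QuantumFieldTheory Literature.MathematicalPhysics.QuantumLattice
open Literature.Probability.LatticeModels
open Summit.QuantumFields.YangMills.Cruxes.OSLegsFromFemtoAndGap.DlrCollarTransfer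
open Summit.QuantumFields.YangMills.Theses.ForcedResponseSkewness

/-- **`FBLPinnedSigR → ScaleFreeLocalPinnedSigR`** (the hypothesis is the body of `ResponseLocalisation.Birth.FBLPinnedSigR`,
the lead's `stub_fblPinned` of line «femto-collar» on the deciding crux, written out: the femto boundary law `FBL G r a` along
a unit map pinned by a compactly supported positive-time floor witness).  So the registered `stub_scaleFreeLocal` of line
«pointwise-log-ceiling-r» is discharged by `stub_fblPinned` — the two cruxes SHARE that stub. [folklore] -/
theorem scaleFreeLocalPinnedSigR_of_fblPinned
    (hFBL : ∀ (G : Type) [Group G] [TopologicalSpace G] [IsTopologicalGroup G] [CompactSpace G],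
      IsCompactSimpleLieGroup G →
      letI : MeasurableSpace G := borel G
      haveI : BorelSpace G := ⟨rfl⟩
      ∀ (r : LatticeRep G) (a : ℝ → ℝ), (∀ β, 0 < a β) → Filter.Tendsto a Filter.atTop (nhds 0) →
        (∃ (v₀ : 𝓢(EuclideanSpace ℝ (Fin 4), ℝ)) (ε β₅ Λ₅ : ℝ), HasCompactSupport v₀ ∧
          tsupport v₀ ⊆ {y : EuclideanSpace ℝ (Fin 4) | 0 < y 0} ∧ 0 < ε ∧
          ∀ β : ℝ, β₅ ≤ β → ∀ L : ℕ, Λ₅ ≤ a β * L → ε ≤ Q2 G r β L (a β) (thetaTest 4 v₀) v₀) →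
        FBL G r a) :
    ScaleFreeLocalPinnedSigR := by
  intro G _ _ _ _ hG
  letI : MeasurableSpace G := borel G
  haveI : BorelSpace G := ⟨rfl⟩
  intro r a ha hlim hpin ℓ hℓ
  exact localScaleFree_of_fbl r ha hlim (hFBL G hG r a ha hlim hpin) ℓ hℓ


/-- **`stub_logCeiling` in the femto currency**: `ScaleFreeLocalPinnedSigR`, the femto boundary law along the pinned unit
(the body of `FBLPinnedSigR` = the lead's `stub_fblPinned` of line «femto-collar», written out) and the FEMTO LOG TWO-POINT LAW
along the pinned unit (INLINE hypothesis: the upper clause of the record's `FC2` with the asymptotic-freedom shape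
`1/log²(1/s)` and one scale-indexed collar `K`, `s·K(s) → 0`) imply the registered `LogCeilingSigR`. [folklore] -/
theorem logCeilingSigR_of_femto (hSF : ScaleFreeLocalPinnedSigR)
    (hFBL : ∀ (G : Type) [Group G] [TopologicalSpace G] [IsTopologicalGroup G] [CompactSpace G],
      IsCompactSimpleLieGroup G →
      letI : MeasurableSpace G := borel G
      haveI : BorelSpace G := ⟨rfl⟩
      ∀ (r : LatticeRep G) (a : ℝ → ℝ), (∀ β, 0 < a β) → Filter.Tendsto a Filter.atTop (nhds 0) →
        (∃ (v₀ : 𝓢(EuclideanSpace ℝ (Fin 4), ℝ)) (ε β₅ Λ₅ : ℝ), HasCompactSupport v₀ ∧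
          tsupport v₀ ⊆ {y : EuclideanSpace ℝ (Fin 4) | 0 < y 0} ∧ 0 < ε ∧
          ∀ β : ℝ, β₅ ≤ β → ∀ L : ℕ, Λ₅ ≤ a β * L → ε ≤ Q2 G r β L (a β) (thetaTest 4 v₀) v₀) →
        FBL G r a)
    (hLog : ∀ (G : Type) [Group G] [TopologicalSpace G] [IsTopologicalGroup G] [CompactSpace G],
      IsCompactSimpleLieGroup G →
      letI : MeasurableSpace G := borel G
      haveI : BorelSpace G := ⟨rfl⟩
      ∀ (r : LatticeRep G) (a : ℝ → ℝ), (∀ β, 0 < a β) → Filter.Tendsto a Filter.atTop (nhds 0) →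
        (∃ (v₀ : 𝓢(EuclideanSpace ℝ (Fin 4), ℝ)) (ε β₅ Λ₅ : ℝ), HasCompactSupport v₀ ∧
          tsupport v₀ ⊆ {y : EuclideanSpace ℝ (Fin 4) | 0 < y 0} ∧ 0 < ε ∧
          ∀ β : ℝ, β₅ ≤ β → ∀ L : ℕ, Λ₅ ≤ a β * L → ε ≤ Q2 G r β L (a β) (thetaTest 4 v₀) v₀) →
        ∃ (ℓ₂ C₂ β₂ : ℝ) (K : ℝ → ℝ) (n₀ : ℕ), 0 < ℓ₂ ∧ (∀ s, 1 ≤ K s) ∧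
          Filter.Tendsto (fun s : ℝ => s * K s) (nhdsWithin 0 (Set.Ioi 0)) (nhds 0) ∧
          ∀ β : ℝ, β₂ ≤ β → ∀ (c : Fin 4 → ℤ) (b : ℕ), (b : ℝ) * a β ≤ ℓ₂ →
            ∀ (η : LGConfig 4 G) (x y : Fin 4 → ℤ), (n₀ : ℝ) ≤ ‖siteToE (y - x)‖ →
              K (‖siteToE (y - x)‖ * a β) * ‖siteToE (y - x)‖ ≤ (depth c b x : ℝ) →
              K (‖siteToE (y - x)‖ * a β) * ‖siteToE (y - x)‖ ≤ (depth c b y : ℝ) →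
                ‖siteToE (y - x)‖ ^ 8 * |kerCov G r β c b η (dens G r x) (dens G r y)| ≤
                  C₂ / Real.log (1 / (‖siteToE (y - x)‖ * a β)) ^ 2) :
    LogCeilingSigR := by
  intro G _ _ _ _ hG
  letI : MeasurableSpace G := borel G
  haveI : BorelSpace G := ⟨rfl⟩
  intro r a ha hlim hpin
  exact logCeiling_of_femto r ha hlim (hSF G hG r a ha hlim hpin (1 / 2) (by norm_num)) (hFBL G hG r a ha hlim hpin)
    (hLog G hG r a ha hlim hpin)

/-! ## §4 The crux by name from the two femto statements -/

/-- **`RunningCouplingCeiling` (stmt-QuantumFields-24275) from FEMTO data**: the femto boundary law and the femto log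
two-point law along the pinned unit imply the crux BY NAME — `stub_scaleFreeLocal` by §1, `stub_logCeiling` by §3, and the
registered composition through `runningCouplingCeiling_of_localKernelBounds` (p594732).  The line «pointwise-log-ceiling-r»
thus closes modulo `stub_fblPinned` (shared with line «femto-collar» of the deciding crux) and ONE femto asymptotic-freedom
statement. [folklore] -/
theorem runningCouplingCeiling_of_femto
    (hFBL : ∀ (G : Type) [Group G] [TopologicalSpace G] [IsTopologicalGroup G] [CompactSpace G],
      IsCompactSimpleLieGroup G →
      letI : MeasurableSpace G := borel G
      haveI : BorelSpace G := ⟨rfl⟩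
      ∀ (r : LatticeRep G) (a : ℝ → ℝ), (∀ β, 0 < a β) → Filter.Tendsto a Filter.atTop (nhds 0) →
        (∃ (v₀ : 𝓢(EuclideanSpace ℝ (Fin 4), ℝ)) (ε β₅ Λ₅ : ℝ), HasCompactSupport v₀ ∧
          tsupport v₀ ⊆ {y : EuclideanSpace ℝ (Fin 4) | 0 < y 0} ∧ 0 < ε ∧
          ∀ β : ℝ, β₅ ≤ β → ∀ L : ℕ, Λ₅ ≤ a β * L → ε ≤ Q2 G r β L (a β) (thetaTest 4 v₀) v₀) →
        FBL G r a)
    (hLog : ∀ (G : Type) [Group G] [TopologicalSpace G] [IsTopologicalGroup G] [CompactSpace G],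
      IsCompactSimpleLieGroup G →
      letI : MeasurableSpace G := borel G
      haveI : BorelSpace G := ⟨rfl⟩
      ∀ (r : LatticeRep G) (a : ℝ → ℝ), (∀ β, 0 < a β) → Filter.Tendsto a Filter.atTop (nhds 0) →
        (∃ (v₀ : 𝓢(EuclideanSpace ℝ (Fin 4), ℝ)) (ε β₅ Λ₅ : ℝ), HasCompactSupport v₀ ∧
          tsupport v₀ ⊆ {y : EuclideanSpace ℝ (Fin 4) | 0 < y 0} ∧ 0 < ε ∧
          ∀ β : ℝ, β₅ ≤ β → ∀ L : ℕ, Λ₅ ≤ a β * L → ε ≤ Q2 G r β L (a β) (thetaTest 4 v₀) v₀) →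
        ∃ (ℓ₂ C₂ β₂ : ℝ) (K : ℝ → ℝ) (n₀ : ℕ), 0 < ℓ₂ ∧ (∀ s, 1 ≤ K s) ∧
          Filter.Tendsto (fun s : ℝ => s * K s) (nhdsWithin 0 (Set.Ioi 0)) (nhds 0) ∧
          ∀ β : ℝ, β₂ ≤ β → ∀ (c : Fin 4 → ℤ) (b : ℕ), (b : ℝ) * a β ≤ ℓ₂ →
            ∀ (η : LGConfig 4 G) (x y : Fin 4 → ℤ), (n₀ : ℝ) ≤ ‖siteToE (y - x)‖ →
              K (‖siteToE (y - x)‖ * a β) * ‖siteToE (y - x)‖ ≤ (depth c b x : ℝ) →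
              K (‖siteToE (y - x)‖ * a β) * ‖siteToE (y - x)‖ ≤ (depth c b y : ℝ) →
                ‖siteToE (y - x)‖ ^ 8 * |kerCov G r β c b η (dens G r x) (dens G r y)| ≤
                  C₂ / Real.log (1 / (‖siteToE (y - x)‖ * a β)) ^ 2) :
    RunningCouplingCeiling := by
  have hSF : ScaleFreeLocalPinnedSigR := scaleFreeLocalPinnedSigR_of_fblPinned hFBL
  have hLC : LogCeilingSigR := logCeilingSigR_of_femto hSF hFBL hLog
  refine runningCouplingCeiling_of_localKernelBounds ?_
  intro G _ _ _ _ hG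
  letI : MeasurableSpace G := borel G
  haveI : BorelSpace G := ⟨rfl⟩
  intro r a hapos hlim hpin ℓ hℓ
  obtain ⟨C₁, n₁, β₁, h1⟩ := hSF G hG r a hapos hlim hpin ℓ hℓ
  obtain ⟨C₀, n₂, β₂, Λ₀, h2⟩ := hLC G hG r a hapos hlim hpin
  refine ⟨C₀, C₁, max n₁ n₂, max β₁ β₂, Λ₀, fun β hβ L hL x hx y hy => ⟨fun hn hd => ?_, fun hn hd => ?_⟩⟩
  · have hn₁ : (n₁ : ℝ) ≤ torusDist L x y := le_trans (by exact_mod_cast le_max_left n₁ n₂) hn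
    exact h1 β (le_trans (le_max_left _ _) hβ) L x y hn₁ hd
  · have hn₂ : (n₂ : ℝ) ≤ torusDist L x y := le_trans (by exact_mod_cast le_max_right n₁ n₂) hn
    exact h2 β (le_trans (le_max_right _ _) hβ) L hL x hx y hy hn₂ hd


end Summit.QuantumFields.YangMills.Cruxes.RunningCouplingCeiling.Pointwise

end
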